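import Literature.Computability.FineGrained.BKGadget
import Literature.Computability.Cryptography.EditDistBlocks
import Mathlib.Data.Bool.Count
import HarnessLib

/-!
# The Bringmann–Künnemann alignment gadget: block structure of the two strings

Bookkeeping for the strings `x = G(x₁) 0^{γ₂} G(x₂) ⋯ 0^{γ₂} G(x_n)` and
`y = 0^{nγ₃} G(y₁) 0^{γ₂} ⋯ G(y_m) 0^{nγ₃}` of the alignment gadget of K. Bringmann, M. Künnemann,
*Quadratic conditional lower bounds for string problems and dynamic time warping*, FOCS 2015
(arXiv:1502.01063), Lemma 5.3 (`BKGadget.Params.gadgetX/gadgetY`, `c_subst = 1`), as used in the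
proof of Lemma 5.4 (ibid., §5.2):

* the blocks `G(xᵢ) 0^{γ₂}` ("`G(xᵢ) Zᵢˣ`" in BK15) and `0^{γ₂} G(xᵢ)`: length `γ₄ + γ₂ = 5(4γ₁ + sₓ)`
  and `4γ₁ + sₓ` ones, i.e. exactly one fifth of the symbols are ones (the choice of `γ₂` in
  Lemma 5.3; `length_guard_append_zeros`, `count_true_guard_append_zeros`, and the versions for
  concatenations of such blocks);
* decompositions of `x` along a decomposition `x₁…x_n = as ++ bs ++ cs` of the inputs
  (`gadgetX_append_left`, `gadgetX_append_right`, `gadgetX_split3`), and of the padded string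
  `0^{γ₂} x 0^{γ₂}` around one block, `0^{γ₂} x 0^{γ₂} = [0^{γ₂}G(x_k)]_{k<i} (0^{γ₂} G(xᵢ) 0^{γ₂}) [G(x_k)0^{γ₂}]_{k>i}`
  (`zeros_append_gadgetX_append_zeros`), which is the frame in which a short substring of `x` is
  a substring of `0^{γ₂} G(xᵢ) 0^{γ₂}` (BK15, proof of Claim 5.9);
* the guards cancel: `editDist (G z) (G w) = editDist z w` (BK15, proof of Lemma 5.4, "(i)":
  "by matching all guarding zeroes and ones");
* reversal: `G(z)ʳ = G(zʳ)` and `xʳ` is the gadget string of the reversed inputs in reverse order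
  (`reverse_guard`, `reverse_gadgetX`), which turns statements about prefixes of `x` into
  statements about suffixes ("symmetric statements hold for any suffix", BK15, Lemma 5.8).

No new definitions are introduced; the blocks are written as `P.guard z ++ zeros P.γ₂` and
`zeros P.γ₂ ++ P.guard z` throughout.
-/

namespace Literature.Computability.FineGrained

open Cryptography

namespace BKGadget

/-! ### Blocks of equal symbols, continued -/

/-- `0^k` has `k` zeros. [folklore] -/
@[simp] theorem count_false_zeros (k : ℕ) : (zeros k).count false = k := by
  simp [zeros]

/-- `1^k` has no zeros. [folklore] -/
@[simp] theorem count_false_ones (k : ℕ) : (ones k).count false = 0 := by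
  simp [ones, List.count_replicate]

/-- `0^k` is a palindrome. [folklore] -/
@[simp] theorem reverse_zeros (k : ℕ) : (zeros k).reverse = zeros k := List.reverse_replicate

/-- `1^k` is a palindrome. [folklore] -/
@[simp] theorem reverse_ones (k : ℕ) : (ones k).reverse = ones k := List.reverse_replicate

/-- In a bit string, `#1 + #0 = length`. [folklore] -/
theorem count_true_add_count_false (l : List Bool) : l.count true + l.count false = l.length :=
  List.count_true_add_count_false l

namespace Params

variable (P : Params)

/-! ### The guard and the blocks `G(z) 0^{γ₂}`, `0^{γ₂} G(z)` -/

/-- The guards cancel (BK15, proof of Lemma 5.4: "by matching all guarding zeroes and ones of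
`G(x_{Δ+j})` and `G(y_j)` we conclude `δ(G(x_{Δ+j}), G(y_j)) ≤ δ(x_{Δ+j}, y_j)`"; with
`editDist_append_left_cancel`/`editDist_append_right_cancel` this is an equality).
[cite: BringmannKunnemannFOCS2015, Lemma 5.4 (proof)] -/
theorem editDist_guard_guard (z w : List Bool) : editDist (P.guard z) (P.guard w) = editDist z w := by
  simp only [guard, List.append_assoc]
  rw [editDist_append_left_cancel, editDist_append_left_cancel, editDist_append_left_cancel,
    editDist_append_left_cancel, editDist_append_right_cancel]

/-- `G(z)` reversed is `G(zʳ)`: the guarding `(1^{γ₁}0^{γ₁})² · (0^{γ₁}1^{γ₁})²` is symmetric.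
[cite: BringmannKunnemannFOCS2015, Lemma 5.3] -/
theorem reverse_guard (z : List Bool) : (P.guard z).reverse = P.guard z.reverse := by
  simp [guard, List.reverse_append, List.append_assoc]

/-- `G(z)` has `4γ₁ + #0(z)` zeros. [folklore] -/
@[simp] theorem count_false_guard (z : List Bool) :
    (P.guard z).count false = 4 * P.γ₁ + z.count false := by
  simp only [guard, List.count_append, count_false_ones, count_false_zeros]; ring

/-- `|G(z) 0^{γ₂}| = γ₄ + γ₂ = 5(4γ₁ + sₓ)` for `|z| = ℓₓ` (BK15, proof of Lemma 5.4:
"`|G(xᵢ) Zᵢˣ| = γ₄ + γ₂`"). [cite: BringmannKunnemannFOCS2015, Lemma 5.4 (proof)] -/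
theorem length_guard_append_zeros (z : List Bool) (hz : z.length = P.ℓx) :
    (P.guard z ++ zeros P.γ₂).length = 5 * (4 * P.γ₁ + P.sx) := by
  rw [← γ₄_add_γ₂, List.length_append, length_guard, length_zeros, hz, γ₄]

/-- `G(z) 0^{γ₂}` has `4γ₁ + sₓ` ones for `#1(z) = sₓ`: one fifth of its length (BK15, proof of
Lemma 5.8: "the parameter `γ₂` is chosen so that the number of zeroes is four times the number of
ones"). [cite: BringmannKunnemannFOCS2015, Lemma 5.8 (proof)] -/
theorem count_true_guard_append_zeros (z : List Bool) (hz : z.count true = P.sx) :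
    (P.guard z ++ zeros P.γ₂).count true = 4 * P.γ₁ + P.sx := by
  rw [List.count_append, count_true_guard, count_true_zeros, hz, Nat.add_zero]

/-- `|0^{γ₂} G(z)| = 5(4γ₁ + sₓ)` for `|z| = ℓₓ`. [cite: BringmannKunnemannFOCS2015, Lemma 5.4 (proof)] -/
theorem length_zeros_append_guard (z : List Bool) (hz : z.length = P.ℓx) :
    (zeros P.γ₂ ++ P.guard z).length = 5 * (4 * P.γ₁ + P.sx) := by
  rw [← P.length_guard_append_zeros z hz, List.length_append, List.length_append, Nat.add_comm]

/-- `0^{γ₂} G(z)` has `4γ₁ + sₓ` ones for `#1(z) = sₓ`. [cite: BringmannKunnemannFOCS2015, Lemma 5.8 (proof)] -/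
theorem count_true_zeros_append_guard (z : List Bool) (hz : z.count true = P.sx) :
    (zeros P.γ₂ ++ P.guard z).count true = 4 * P.γ₁ + P.sx := by
  rw [List.count_append, count_true_guard, count_true_zeros, hz, Nat.zero_add]

/-- Length of a concatenation of blocks `G(z) 0^{γ₂}`, all `z` of length `ℓₓ`. [folklore] -/
theorem length_flatten_map_guard_append_zeros (as : List (List Bool))
    (h : ∀ z ∈ as, z.length = P.ℓx) :
    (as.map fun z => P.guard z ++ zeros P.γ₂).flatten.length = as.length * (5 * (4 * P.γ₁ + P.sx)) := by
  induction as with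
  | nil => simp
  | cons a as ih =>
      rw [List.map_cons, List.flatten_cons, List.length_append,
        P.length_guard_append_zeros a (h a (by simp)), ih fun z hz => h z (by simp [hz]),
        List.length_cons]
      ring

/-- Number of ones of a concatenation of blocks `G(z) 0^{γ₂}`, all `z` with `sₓ` ones. [folklore] -/
theorem count_true_flatten_map_guard_append_zeros (as : List (List Bool))
    (h : ∀ z ∈ as, z.count true = P.sx) :
    (as.map fun z => P.guard z ++ zeros P.γ₂).flatten.count true = as.length * (4 * P.γ₁ + P.sx) := by
  induction as with
  | nil => simp
  | cons a as ih =>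
      rw [List.map_cons, List.flatten_cons, List.count_append,
        P.count_true_guard_append_zeros a (h a (by simp)), ih fun z hz => h z (by simp [hz]),
        List.length_cons]
      ring

/-- Length of a concatenation of blocks `0^{γ₂} G(z)`, all `z` of length `ℓₓ`. [folklore] -/
theorem length_flatten_map_zeros_append_guard (as : List (List Bool))
    (h : ∀ z ∈ as, z.length = P.ℓx) :
    (as.map fun z => zeros P.γ₂ ++ P.guard z).flatten.length = as.length * (5 * (4 * P.γ₁ + P.sx)) := by
  induction as with
  | nil => simp
  | cons a as ih =>
      rw [List.map_cons, List.flatten_cons, List.length_append,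
        P.length_zeros_append_guard a (h a (by simp)), ih fun z hz => h z (by simp [hz]),
        List.length_cons]
      ring

/-- Number of ones of a concatenation of blocks `0^{γ₂} G(z)`, all `z` with `sₓ` ones. [folklore] -/
theorem count_true_flatten_map_zeros_append_guard (as : List (List Bool))
    (h : ∀ z ∈ as, z.count true = P.sx) :
    (as.map fun z => zeros P.γ₂ ++ P.guard z).flatten.count true = as.length * (4 * P.γ₁ + P.sx) := by
  induction as with
  | nil => simp
  | cons a as ih =>
      rw [List.map_cons, List.flatten_cons, List.count_append,
        P.count_true_zeros_append_guard a (h a (by simp)), ih fun z hz => h z (by simp [hz]),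
        List.length_cons]
      ring

/-! ### Decompositions of `x` -/

/-- `x` for a single input is its guarded version: `gadgetX [z] = G(z)`. [cite: BringmannKunnemannFOCS2015, Lemma 5.3] -/
@[simp] theorem gadgetX_singleton (z : List Bool) : P.gadgetX [z] = P.guard z := by
  simp [gadgetX]

/-- `gadgetX [] = []`. [folklore] -/
@[simp] theorem gadgetX_nil : P.gadgetX [] = [] := by
  simp [gadgetX]

/-- Peeling the first block: `gadgetX (a :: bs) = G(a) 0^{γ₂} gadgetX bs` for `bs ≠ []`.
[cite: BringmannKunnemannFOCS2015, Lemma 5.3] -/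
theorem gadgetX_cons (a : List Bool) {bs : List (List Bool)} (hbs : bs ≠ []) :
    P.gadgetX (a :: bs) = P.guard a ++ zeros P.γ₂ ++ P.gadgetX bs := by
  obtain ⟨b, bs', rfl⟩ := List.exists_cons_of_ne_nil hbs
  simp [gadgetX, List.intercalate_cons_cons, List.append_assoc]

/-- Splitting off leading blocks: `gadgetX (as ++ bs) = [G(a) 0^{γ₂}]_{a ∈ as} ++ gadgetX bs` for
`bs ≠ []`. [cite: BringmannKunnemannFOCS2015, Lemma 5.4 (proof)] -/
theorem gadgetX_append_left (as : List (List Bool)) {bs : List (List Bool)} (hbs : bs ≠ []) :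
    P.gadgetX (as ++ bs) = (as.map fun z => P.guard z ++ zeros P.γ₂).flatten ++ P.gadgetX bs := by
  induction as with
  | nil => simp
  | cons a as ih =>
      rw [List.cons_append, P.gadgetX_cons a (by simp [hbs]), ih, List.map_cons,
        List.flatten_cons]
      simp only [List.append_assoc]

/-- Splitting off trailing blocks after one block: `gadgetX (b :: cs) = G(b) ++ [0^{γ₂} G(c)]_{c ∈ cs}`.
[cite: BringmannKunnemannFOCS2015, Lemma 5.4 (proof)] -/
theorem gadgetX_cons_eq_append_flatten (b : List Bool) (cs : List (List Bool)) :
    P.gadgetX (b :: cs) = P.guard b ++ (cs.map fun z => zeros P.γ₂ ++ P.guard z).flatten := by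
  induction cs generalizing b with
  | nil => simp
  | cons c cs ih =>
      rw [P.gadgetX_cons b (List.cons_ne_nil _ _), ih c, List.map_cons, List.flatten_cons,
        List.append_assoc, List.append_assoc]

/-- Splitting off trailing blocks: `gadgetX (bs ++ cs) = gadgetX bs ++ [0^{γ₂} G(c)]_{c ∈ cs}` for
`bs ≠ []`. [cite: BringmannKunnemannFOCS2015, Lemma 5.4 (proof)] -/
theorem gadgetX_append_right {bs : List (List Bool)} (hbs : bs ≠ []) (cs : List (List Bool)) :
    P.gadgetX (bs ++ cs) = P.gadgetX bs ++ (cs.map fun z => zeros P.γ₂ ++ P.guard z).flatten := by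
  induction bs with
  | nil => exact absurd rfl hbs
  | cons b bs ih =>
      rcases bs with _ | ⟨b', bs'⟩
      · simpa using P.gadgetX_cons_eq_append_flatten b cs
      · rw [List.cons_append, P.gadgetX_cons b (by simp), P.gadgetX_cons b (by simp),
          ih (by simp)]
        simp only [List.append_assoc]

/-- The three-way decomposition of `x` along `x₁…x_n = as ++ bs ++ cs` with `bs ≠ []` (BK15, proof
of Lemma 5.4, the ordered partition `x(Lʸ), …, x(Rʸ)`):
`x = [G(a)0^{γ₂}]_{a∈as} ++ gadgetX bs ++ [0^{γ₂}G(c)]_{c∈cs}`. [cite: BringmannKunnemannFOCS2015, Lemma 5.4 (proof)] -/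
theorem gadgetX_split3 (as : List (List Bool)) {bs : List (List Bool)} (hbs : bs ≠ [])
    (cs : List (List Bool)) :
    P.gadgetX (as ++ bs ++ cs) = (as.map fun z => P.guard z ++ zeros P.γ₂).flatten ++
      P.gadgetX bs ++ (cs.map fun z => zeros P.γ₂ ++ P.guard z).flatten := by
  rw [List.append_assoc, P.gadgetX_append_left as (by simp [hbs]), P.gadgetX_append_right hbs,
    List.append_assoc]

/-- Shifting the separators: `0^{γ₂} [G(a)0^{γ₂}]_{a∈as} = [0^{γ₂}G(a)]_{a∈as} 0^{γ₂}`. [folklore] -/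
theorem zeros_append_flatten_map (as : List (List Bool)) :
    zeros P.γ₂ ++ (as.map fun z => P.guard z ++ zeros P.γ₂).flatten =
      (as.map fun z => zeros P.γ₂ ++ P.guard z).flatten ++ zeros P.γ₂ := by
  induction as with
  | nil => simp
  | cons a as ih =>
      simp only [List.map_cons, List.flatten_cons, List.append_assoc]
      rw [ih]

/-- **The frame around one block** (BK15, proof of Claim 5.9: a substring of `x` shorter than
`γ₂` "is a substring of `0^{γ₂} G(xᵢ) 0^{γ₂}` for some `i`"): padding `x` by `0^{γ₂}` on both sides,
`0^{γ₂} x 0^{γ₂} = [0^{γ₂}G(a)]_{a∈as} ++ (0^{γ₂} G(xᵢ) 0^{γ₂}) ++ [G(c)0^{γ₂}]_{c∈cs}` for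
`x₁…x_n = as ++ [xᵢ] ++ cs`; the first part has length `|as|·(γ₄+γ₂)`.
[cite: BringmannKunnemannFOCS2015, Claim 5.9 (proof)] -/
theorem zeros_append_gadgetX_append_zeros (as : List (List Bool)) (xi : List Bool)
    (cs : List (List Bool)) :
    zeros P.γ₂ ++ P.gadgetX (as ++ [xi] ++ cs) ++ zeros P.γ₂ =
      (as.map fun z => zeros P.γ₂ ++ P.guard z).flatten ++
        (zeros P.γ₂ ++ P.guard xi ++ zeros P.γ₂) ++
        (cs.map fun z => P.guard z ++ zeros P.γ₂).flatten := by
  rw [P.gadgetX_split3 as (List.cons_ne_nil _ _) cs, gadgetX_singleton, ← List.append_assoc,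
    ← List.append_assoc, P.zeros_append_flatten_map as]
  simp only [List.append_assoc, List.append_cancel_left_eq]
  rw [← P.zeros_append_flatten_map cs]

/-! ### Reversal -/

/-- Reversing `x`: `(gadgetX [x₁,…,x_n])ʳ = gadgetX [x_nʳ,…,x₁ʳ]` (the separators and guards are
symmetric), so every suffix of `x` is, reversed, a prefix of a gadget string of inputs of the same
type (BK15, Lemma 5.8: "symmetric statements hold for any suffix of `x`").
[cite: BringmannKunnemannFOCS2015, Lemma 5.8] -/
theorem reverse_gadgetX (xs : List (List Bool)) :
    (P.gadgetX xs).reverse = P.gadgetX (xs.map List.reverse).reverse := by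
  induction xs with
  | nil => simp
  | cons a xs ih =>
      rcases eq_or_ne xs [] with rfl | hxs
      · simp [reverse_guard]
      · rw [P.gadgetX_cons a hxs, List.reverse_append, List.reverse_append, ih, reverse_zeros,
          reverse_guard, List.map_cons, List.reverse_cons,
          P.gadgetX_append_right (by simpa using hxs) [a.reverse]]
        simp

end Params

end BKGadget

end Literature.Computability.FineGrained
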